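/- Free-seat work of EXTRA WIDTH SEAT `ym-line-cbag-p1-w4` (prover-ym-line-cbag-p1-w4-g2-0), route `EguchiKawaiDirectionLadder`
(ideator ym-idea-2, LINE 8), crux `TripleSmallBallMargin` (stmt-QuantumFields-27724): CAPSTONE v3, part 2, of stub S9 «Abs» of the LEAD's
v7 architecture (ARCH-27724-lead-g24 §3(ii)–(iii); assembly contract F1–F4): the one-level decoupling inequality with per-block factor
`min{ρ_c·ρ_c, ψ_c}` — within-block RIGIDITY branch AND rank-robust COMMUTATOR branch, all slacks LINEAR — composed from part 1
(`haar_prod_le_prod_blockEvent_mul_linear`), `compression_split_labels_opNorm` and the LEAD's block-local fibre bound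
`blockPairFibre_le_min` (p644641).  ROUTE-INDEPENDENT.  Nothing here bears on the Yang–Mills mass gap. -/
import Summits.QuantumFields.YangMills.Theorems.EguchiKawaiDirectionLadderBlockDecouplingLinear
import Summits.QuantumFields.YangMills.Theorems.EguchiKawaiDirectionLadderCompressionSplitLabelsOpNorm
import Summits.QuantumFields.YangMills.Theorems.EguchiKawaiDirectionLadderBlockPairFibre
import HarnessLib

/-!
# Route `EguchiKawaiDirectionLadder`: one decoupling level with per-block factor `min{ρ_c², ψ_c}` (S9 capstone v3, part 2)

`haar_prod_le_prod_min_mul` — setting of `…BlockDecouplingLinear` (labelling `ℓ`, blocks `T`, collar labels `near`, `q := Σ_{a∈near}#{ℓ=a}`,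
measurable pair event `E`, off-block sets `A₁, A₂`, (h_off), (h_block) with budget `s`, (h_far) LINEAR far pair mass `≤ Φ`), plus phases
`d : Fin N → ℂ` with `|d_i| ≤ 1` and:
(h_rig₁/₂) on `E`, in every block `c ∈ T`, both links are entrywise rigid: `Σ_{i,j∈c} |d_i − d_j|²|(X·ι(D))_{ij}|² ≤ s₁` (same for `Y·ι(D′)`);
(h_far₁) far compression masses `Σ_{a≠c, a∉near} Σ|X_{ca}|² ≤ Φ₁` on `A₁ ∪ A₂`;
(h_p) `min{ρ_c·ρ_c, ψ_c} ≤ p c` for `c ∈ T`, where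
`ρ_c = Haar_c{V′ : ∃ R′, rk R′ ≤ 2q, Σ|diag(d|_c)V′ − V′diag(d|_c) − R′|² ≤ 2s₁ + 8Φ₁}`,
`ψ_c = Haar_c²{(P₁,P₂) : ∃ L, rk L ≤ 2q + 2(q+q), Σ|P₁P₂ − P₂P₁ − L|² ≤ 2(2s + 2Φ) + 36(Φ₁ + Φ₁)}`.
Conclusion: `Haar²(E) ≤ (∏_{c∈T} p c) · Haar²(A₁ ×ˢ A₂)`.

HONEST FRAMING: bookkeeping; the small-ball inputs (bounds on `ρ_c`, `ψ_c`) and `Haar²(A₁ ×ˢ A₂)` are hypotheses.  The route bears on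
the barrier-ledger fact `EguchiKawaiBreakdown` only.
-/

set_option autoImplicit false

noncomputable section

open MeasureTheory
open scoped Matrix ENNReal Matrix.Norms.L2Operator
open Literature.Barriers.QuantumFields

namespace Summit.QuantumFields.YangMills.Theorems.EguchiKawaiDirectionLadder

variable {N m : ℕ}

/-- **ONE DECOUPLING LEVEL, composed form: per-block factor `min{ρ_c·ρ_c, ψ_c}` (F1–F4, all slacks linear).**  See the module docstring. -/
theorem haar_prod_le_prod_min_mul (ℓ : Fin N → Fin m) (T near : Finset (Fin m)) {E : Set (UN N × UN N)}
    (hE : MeasurableSet E) (A₁ A₂ : Set (UN N)) (d : Fin N → ℂ) (hd : ∀ i, ‖d i‖ ≤ 1) {s Φ s₁ Φ₁ : ℝ}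
    (p : Fin m → ℝ≥0∞)
    (h_off : ∀ (X Y : UN N) (W : BlockUnitaryPairs ℓ),
      (X * blockDiagUnitary ℓ (fstOn T W), Y * blockDiagUnitary ℓ (sndOn T W)) ∈ E → X ∈ A₁ ∧ Y ∈ A₂)
    (h_block : ∀ (X Y : UN N) (W : BlockUnitaryPairs ℓ),
      (X * blockDiagUnitary ℓ (fstOn T W), Y * blockDiagUnitary ℓ (sndOn T W)) ∈ E → ∀ c ∈ T,
        ∑ i, ∑ j, ‖((X : Matrix (Fin N) (Fin N) ℂ) *
              blockDiag ℓ (fun a => (fstOn T W a : Matrix {i : Fin N // ℓ i = a} {i : Fin N // ℓ i = a} ℂ)) *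
            ((Y : Matrix (Fin N) (Fin N) ℂ) *
              blockDiag ℓ (fun a => (sndOn T W a : Matrix {i : Fin N // ℓ i = a} {i : Fin N // ℓ i = a} ℂ))) -
          (Y : Matrix (Fin N) (Fin N) ℂ) *
              blockDiag ℓ (fun a => (sndOn T W a : Matrix {i : Fin N // ℓ i = a} {i : Fin N // ℓ i = a} ℂ)) *
            ((X : Matrix (Fin N) (Fin N) ℂ) *
              blockDiag ℓ (fun a => (fstOn T W a : Matrix {i : Fin N // ℓ i = a} {i : Fin N // ℓ i = a} ℂ)))).toBlock
            (fun i => ℓ i = c) (fun i => ℓ i = c) i j‖ ^ 2 ≤ s)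
    (h_rig₁ : ∀ (X Y : UN N) (W : BlockUnitaryPairs ℓ),
      (X * blockDiagUnitary ℓ (fstOn T W), Y * blockDiagUnitary ℓ (sndOn T W)) ∈ E → ∀ c ∈ T,
        ∑ i, ∑ j, ‖d i.1 - d j.1‖ ^ 2 *
          ‖((X * blockDiagUnitary ℓ (fstOn T W) : UN N) : Matrix (Fin N) (Fin N) ℂ).toBlock
            (fun i => ℓ i = c) (fun i => ℓ i = c) i j‖ ^ 2 ≤ s₁)
    (h_rig₂ : ∀ (X Y : UN N) (W : BlockUnitaryPairs ℓ),
      (X * blockDiagUnitary ℓ (fstOn T W), Y * blockDiagUnitary ℓ (sndOn T W)) ∈ E → ∀ c ∈ T,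
        ∑ i, ∑ j, ‖d i.1 - d j.1‖ ^ 2 *
          ‖((Y * blockDiagUnitary ℓ (sndOn T W) : UN N) : Matrix (Fin N) (Fin N) ℂ).toBlock
            (fun i => ℓ i = c) (fun i => ℓ i = c) i j‖ ^ 2 ≤ s₁)
    (h_far : ∀ X ∈ A₁, ∀ Y ∈ A₂, ∀ c ∈ T,
      2 * ((Finset.univ.erase c).filter (fun a => a ∉ near)).card *
        ∑ a ∈ (Finset.univ.erase c).filter (fun a => a ∉ near),
          ((∑ i, ∑ j, ‖(X : Matrix (Fin N) (Fin N) ℂ).toBlock (fun i => ℓ i = c) (fun i => ℓ i = a) i j‖ ^ 2) +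
            ∑ i, ∑ j, ‖(Y : Matrix (Fin N) (Fin N) ℂ).toBlock (fun i => ℓ i = c) (fun i => ℓ i = a) i j‖ ^ 2) ≤ Φ)
    (h_far₁ : ∀ X ∈ A₁ ∪ A₂, ∀ c ∈ T,
      ∑ a ∈ (Finset.univ.erase c).filter (fun a => a ∉ near),
        ∑ i, ∑ j, ‖(X : Matrix (Fin N) (Fin N) ℂ).toBlock (fun i => ℓ i = c) (fun i => ℓ i = a) i j‖ ^ 2 ≤ Φ₁)
    (h_p : ∀ c ∈ T,
      min
        ((Literature.MathematicalPhysics.QuantumFieldTheory.haarProbability (Matrix.unitaryGroup {i : Fin N // ℓ i = c} ℂ))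
            {V' : Matrix.unitaryGroup {i : Fin N // ℓ i = c} ℂ | ∃ R' : Matrix {i : Fin N // ℓ i = c} {i : Fin N // ℓ i = c} ℂ,
              R'.rank ≤ 2 * ∑ a ∈ near, Fintype.card {i : Fin N // ℓ i = a} ∧
              ∑ i, ∑ j, ‖(Matrix.diagonal (fun i : {i : Fin N // ℓ i = c} => d i.1) *
                  (V' : Matrix {i : Fin N // ℓ i = c} {i : Fin N // ℓ i = c} ℂ) -
                (V' : Matrix {i : Fin N // ℓ i = c} {i : Fin N // ℓ i = c} ℂ) *
                  Matrix.diagonal (fun i : {i : Fin N // ℓ i = c} => d i.1) - R') i j‖ ^ 2 ≤ 2 * s₁ + 8 * Φ₁} *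
          (Literature.MathematicalPhysics.QuantumFieldTheory.haarProbability (Matrix.unitaryGroup {i : Fin N // ℓ i = c} ℂ))
            {V' : Matrix.unitaryGroup {i : Fin N // ℓ i = c} ℂ | ∃ R' : Matrix {i : Fin N // ℓ i = c} {i : Fin N // ℓ i = c} ℂ,
              R'.rank ≤ 2 * ∑ a ∈ near, Fintype.card {i : Fin N // ℓ i = a} ∧
              ∑ i, ∑ j, ‖(Matrix.diagonal (fun i : {i : Fin N // ℓ i = c} => d i.1) *
                  (V' : Matrix {i : Fin N // ℓ i = c} {i : Fin N // ℓ i = c} ℂ) -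
                (V' : Matrix {i : Fin N // ℓ i = c} {i : Fin N // ℓ i = c} ℂ) *
                  Matrix.diagonal (fun i : {i : Fin N // ℓ i = c} => d i.1) - R') i j‖ ^ 2 ≤ 2 * s₁ + 8 * Φ₁})
        ((Literature.MathematicalPhysics.QuantumFieldTheory.haarProbability (Matrix.unitaryGroup {i : Fin N // ℓ i = c} ℂ)).prod
          (Literature.MathematicalPhysics.QuantumFieldTheory.haarProbability (Matrix.unitaryGroup {i : Fin N // ℓ i = c} ℂ))
          {P | ∃ L : Matrix {i : Fin N // ℓ i = c} {i : Fin N // ℓ i = c} ℂ,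
            L.rank ≤ 2 * ∑ a ∈ near, Fintype.card {i : Fin N // ℓ i = a} +
              2 * (∑ a ∈ near, Fintype.card {i : Fin N // ℓ i = a} + ∑ a ∈ near, Fintype.card {i : Fin N // ℓ i = a}) ∧
            ∑ i, ∑ j, ‖((P.1 : Matrix {i : Fin N // ℓ i = c} {i : Fin N // ℓ i = c} ℂ) *
                (P.2 : Matrix {i : Fin N // ℓ i = c} {i : Fin N // ℓ i = c} ℂ) -
              (P.2 : Matrix {i : Fin N // ℓ i = c} {i : Fin N // ℓ i = c} ℂ) *
                (P.1 : Matrix {i : Fin N // ℓ i = c} {i : Fin N // ℓ i = c} ℂ) - L) i j‖ ^ 2 ≤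
              2 * (2 * s + 2 * Φ) + 36 * (Φ₁ + Φ₁)}) ≤ p c) :
    (Literature.MathematicalPhysics.QuantumFieldTheory.haarProbability (UN N)).prod
        (Literature.MathematicalPhysics.QuantumFieldTheory.haarProbability (UN N)) E ≤
      (∏ c ∈ T, p c) *
        (Literature.MathematicalPhysics.QuantumFieldTheory.haarProbability (UN N)).prod
          (Literature.MathematicalPhysics.QuantumFieldTheory.haarProbability (UN N)) (A₁ ×ˢ A₂) := by
  classical
  refine haar_prod_le_prod_blockEvent_mul_linear ℓ T near hE A₁ A₂ (s := s) (Φ := Φ)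
    (fun c X Y => {V |
      ∑ i, ∑ j, ‖d i.1 - d j.1‖ ^ 2 *
          ‖((X : Matrix (Fin N) (Fin N) ℂ).toBlock (fun i => ℓ i = c) (fun i => ℓ i = c) *
            (V.1 : Matrix {i : Fin N // ℓ i = c} {i : Fin N // ℓ i = c} ℂ)) i j‖ ^ 2 ≤ s₁ ∧
      ∑ i, ∑ j, ‖d i.1 - d j.1‖ ^ 2 *
          ‖((Y : Matrix (Fin N) (Fin N) ℂ).toBlock (fun i => ℓ i = c) (fun i => ℓ i = c) *
            (V.2 : Matrix {i : Fin N // ℓ i = c} {i : Fin N // ℓ i = c} ℂ)) i j‖ ^ 2 ≤ s₁}) p h_off h_block ?_ h_far ?_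
  · -- h_G: the rigidity conditions on `E` are conditions on `X_cc·D_c`, `Y_cc·D′_c`
    intro X Y W hW c hc
    have h1 := h_rig₁ X Y W hW c hc
    have h2 := h_rig₂ X Y W hW c hc
    rw [toBlock_coe_mul_blockDiagUnitary, fstOn_of_mem W hc] at h1
    rw [toBlock_coe_mul_blockDiagUnitary, sndOn_of_mem W hc] at h2
    exact ⟨h1, h2⟩
  · -- h_p: compression split with the operator-norm bound, then the LEAD's block-local fibre bound
    intro X hX Y hY c hc
    have hX₁ : X ∈ A₁ ∪ A₂ := Set.mem_union_left _ hX
    have hY₁ : Y ∈ A₁ ∪ A₂ := Set.mem_union_right _ hY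
    obtain ⟨Θ₁, R₁, S₁, hΘ₁, hR₁, hS₁, hop₁, hXc⟩ := compression_split_labels_opNorm ℓ X c near
    obtain ⟨Θ₂, R₂, S₂, hΘ₂, hR₂, hS₂, hop₂, hYc⟩ := compression_split_labels_opNorm ℓ Y c near
    have hS₁' : ∑ i, ∑ j, ‖S₁ i j‖ ^ 2 ≤ Φ₁ := hS₁.trans (h_far₁ X hX₁ c hc)
    have hS₂' : ∑ i, ∑ j, ‖S₂ i j‖ ^ 2 ≤ Φ₁ := hS₂.trans (h_far₁ Y hY₁ c hc)
    have hdc : ∀ i : {i : Fin N // ℓ i = c}, ‖d i.1‖ ≤ 1 := fun i => hd i.1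
    have hfib := blockPairFibre_le_min (k := 2 * ∑ a ∈ near, Fintype.card {i : Fin N // ℓ i = a}) (s₁ := s₁)
      (s := 2 * s + 2 * Φ) ⟨Θ₁, hΘ₁⟩ ⟨Θ₂, hΘ₂⟩ R₁ S₁ R₂ S₂ (fun i : {i : Fin N // ℓ i = c} => d i.1) hdc
      hR₁ hR₂ hS₁' hS₂' hop₁ hop₂
    refine le_trans ?_ (hfib.trans (h_p c hc))
    refine measure_mono ?_
    intro V hV
    simp only [Set.mem_inter_iff, Set.mem_setOf_eq] at hV ⊢
    obtain ⟨⟨h1, h2⟩, L, hL, h3⟩ := hV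
    rw [hXc] at h1 h3
    rw [hYc] at h2 h3
    exact ⟨h1, h2, L, hL, h3⟩

end Summit.QuantumFields.YangMills.Theorems.EguchiKawaiDirectionLadder

end
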